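import Summits.QuantumFields.BalabanUV.T4Continuum.Support.DirichletDecoupledFamilies
import Mathlib.Combinatorics.SimpleGraph.Connectivity.Finite

/-!
# `BalabanUV.T4Continuum.Support.DirichletDecoupledComponents` — NE2 (node U1a) formalisation swarm, SUPPLIER item «Δ1-DECOUPLE» under the
# owner's sub-row `T4-U1a.S-NE2-D1-DIRICHLET°` (wall `hinj`), module (4): THE CANONICAL DECOMPOSITION — the FACE-CONNECTED COMPONENTS of a
# set of unit blocks are pairwise SEPARATED, so the `U = 1` scalar Dirichlet two-level law holds for EVERY block set all of whose
# face-connected components are LOCALLY MONOTONE (rate `(√L)⁻¹` along the tower) or COORDINATE BOXES (full rate `L⁻¹`) — the class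
# statement of Δ1's scalar layer with NO user-supplied decomposition (unit b2b-balaban-t4-ne2-formalise-leaf-08, gen 4, v1)

HONEST FRAMING.  Rung (B)+1 bookkeeping at MODEL level (U = 1 scalar layer `Δ′ = Δ + a′Π′` of [B9] (3.24), King's planting, road P2's
compressed carriers BY NAME), finite torus; combinatorics of Mathlib's `SimpleGraph.ConnectedComponent` over module (3)'s family law —
NOT a new analytic estimate; NE2 (U1a) is NOT proved by this file; Δ1 NOT closed; spine PROVED 0/9 unchanged; NOT infinite volume, NOT
the mass gap, NOT Clay.  HONEST DEPENDENCY (verbatim): «continuum YM on T⁴ ⇐ BetaPertH ∧ nine spine estimates (0/9 proved); BetaPertH ⇐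
(D1) ∧ (D4) ∧ CAP+tail; G-an2-4 gates asym, D1 and NE2/3/4.»

WHAT THIS FILE PROVES (0 sorry):
 * §1 `faceGraph M` (the face graph of the block torus: `b ~ b′` iff `b ≠ b′` and `b′ = b ± e_μ`), `faceGraphOn M S` (induced on `S`),
   [shape] **`compOf M S c`** (the face-connected component `c` as a block set), `iff_exists_compOf` (`S` = the union of its components
   over `Finset.univ`), **`separated_compOf`**: DISTINCT COMPONENTS ARE `Separated` (an equal block is the same vertex; a face-adjacent
   pair is an edge, hence reachable);
 * §2 **`injected_le_of_components_locallyMonotone`** (`besovConst d a′ 6 48·√R/√N`) and **`injected_le_of_components_box`**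
   (`Cbox d R a′/N`) at every `(N, R, a′)`; **`towerLimitRate_dirichletScalar_components_monotone`** (rate `(√L)⁻¹`) and
   **`towerLimitRate_dirichletScalar_components_box`** (FULL rate `L⁻¹`) — displayed binders `2 ≤ L`, `0 < d`, `0 < a′` and the class
   of EACH COMPONENT (`∀ c, LocallyMonotone M (compOf M S c)`, resp. `IsCoordBox`); nothing else.
Decidability: `faceGraph`∕`faceGraphOn` adjacency are decidable instances; component membership `compOf` is decided classically (it never
enters a displayed statement about `S`, whose own `DecidablePred` instance is the user's).
 * §3 (v1.1, APPEND-ONLY; ne5-leaf-07 g9's XREAD INFO-1, journal l.17454): **`locallyMonotone_compOf`** — the WHOLE-SET class implies the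
   COMPONENT class (`LocallyMonotone M S → ∀ c, LocallyMonotone M (compOf M S c)`: a block of `S` and its face-neighbour inside `S` lie in
   the same component), so leaf-08 g3's `towerLimitRate_dirichletScalar_monotone` is LITERALLY the special case of §2 (kernel `example`).

ABSOLUTE RULE (cell, verbatim): «No internally-minted statement may enter as a cited fact. Every hypothesis is either kernel-proved in
this package or a verbatim quotation of a PUBLISHED theorem with page reference. The manuscript(s) under audit are NOT citable for
their own disputed steps — they are the thing under adjudication; programme-internal (2001/route/tribunal) claims are never citable.»
[folklore]; no `def … : Prop` fact (`compOf` is a shape predicate with parameters; `faceGraph`∕`faceGraphOn` are data); nothing printed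
is a hypothesis.  NOT CLAIMED: sets with a face-connected NON-monotone component (the 4-chain around a vertex and its kin — the located
residue of Δ1's scalar layer); the VECTOR layer; [B9] (3.23)–(3.27) as printed; NE2; NE3; «not in print; our proof».
-/

noncomputable section

open scoped BigOperators ComplexConjugate Matrix Matrix.Norms.L2Operator
open Finset Filter Topology

namespace Summit.QuantumFields.BalabanUV.T4Continuum.DirichletDecoupledComponents

open Literature.MathematicalPhysics.QuantumFieldTheory.Balaban1983to89.B5Prop11Plancherel (Tor fine unitVec)
open Literature.MathematicalPhysics.QuantumFieldTheory.Balaban1983to89.B5G183RateUnitTower (lev lev_neZero)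
open Summit.QuantumFields.BalabanUV.T4Continuum
open Summit.QuantumFields.BalabanUV.T4Continuum.CovariantAveragingTower (TowerLimitRate)
open Summit.QuantumFields.BalabanUV.T4Continuum.BackgroundResolventTower
open Summit.QuantumFields.BalabanUV.T4Continuum.ScalarAveragedPropagator (gammaPs)
open Summit.QuantumFields.BalabanUV.T4Continuum.DirichletScalarTower (DsR QsR JsR)
open Summit.QuantumFields.BalabanUV.T4Continuum.DirichletBesovTwoLevel (besovConst)
open Summit.QuantumFields.BalabanUV.T4Continuum.DirichletMonotoneCutoff (LocallyMonotone)
open Summit.QuantumFields.BalabanUV.T4Continuum.DirichletDecoupledRegions (Separated)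
open Summit.QuantumFields.BalabanUV.T4Continuum.DirichletDecoupledFamilies (injected_le_of_pairwise_separated_locallyMonotone
  injected_le_of_pairwise_separated_box towerLimitRate_dirichletScalar_family_monotone towerLimitRate_dirichletScalar_family_box)
open Summit.QuantumFields.BalabanUV.Beta.GAN24.DirichletBoxTrace (blockReg)
open Summit.QuantumFields.BalabanUV.Beta.GAN24.DirichletBoxCompression (DOm JOm refineR)
open Summit.QuantumFields.BalabanUV.Beta.GAN24.DirichletBoxTwoLevel (IsCoordBox Cbox)

variable {d : ℕ} (M : Fin d → ℕ) [hM : ∀ μ, NeZero (M μ)]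

/-! ## §1 The face graph of the block torus and the face-connected components of a block set -/

/-- the FACE graph of the block torus: two distinct blocks are adjacent iff one is the other translated by one unit vector. [folklore] -/
def faceGraph : SimpleGraph (Tor M) where
  Adj b b' := b ≠ b' ∧ ∃ μ, b' = b + unitVec M μ ∨ b = b' + unitVec M μ
  symm := ⟨fun _ _ h => ⟨h.1.symm, h.2.elim fun μ hμ => ⟨μ, hμ.symm⟩⟩⟩
  loopless := ⟨fun _ h => h.1 rfl⟩

omit hM in
/-- adjacency in the face graph, as an `iff`. [folklore] -/
theorem faceGraph_adj (b b' : Tor M) : (faceGraph M).Adj b b' ↔ (b ≠ b' ∧ ∃ μ, b' = b + unitVec M μ ∨ b = b' + unitVec M μ) := Iff.rfl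

/-- the face graph INDUCED on the blocks of `S`. [folklore] -/
def faceGraphOn (S : Tor M → Prop) : SimpleGraph {b // S b} := (faceGraph M).comap fun b => (b : Tor M)

omit hM in
/-- adjacency in the induced face graph is adjacency of the underlying blocks. [folklore] -/
theorem faceGraphOn_adj (S : Tor M → Prop) (u v : {b // S b}) : (faceGraphOn M S).Adj u v ↔ (faceGraph M).Adj u v := Iff.rfl

/-- face adjacency is decidable. [folklore] -/
instance decFaceAdj : DecidableRel (faceGraph M).Adj :=
  fun b b' => inferInstanceAs (Decidable (b ≠ b' ∧ ∃ μ, b' = b + unitVec M μ ∨ b = b' + unitVec M μ))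

/-- induced face adjacency is decidable. [folklore] -/
instance decFaceOnAdj (S : Tor M → Prop) : DecidableRel (faceGraphOn M S).Adj :=
  fun u v => inferInstanceAs (Decidable ((faceGraph M).Adj u v))

/-- [shape] the FACE-CONNECTED COMPONENT `c` of `S`, as a block set. [folklore] -/
def compOf (S : Tor M → Prop) (c : (faceGraphOn M S).ConnectedComponent) : Tor M → Prop :=
  fun b => ∃ h : S b, (faceGraphOn M S).connectedComponentMk ⟨b, h⟩ = c

variable {M} (S : Tor M → Prop) [DecidablePred S]

/-- membership in a component: decided classically (it never enters a displayed statement about `S`). [folklore] -/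
instance decCompOf (c : (faceGraphOn M S).ConnectedComponent) : DecidablePred (compOf M S c) := Classical.decPred _

omit hM [DecidablePred S] in
/-- a component is a subset of `S`. [folklore] -/
theorem compOf_sub {c : (faceGraphOn M S).ConnectedComponent} {b : Tor M} (h : compOf M S c b) : S b := h.1

/-- `S` is the union of its face-connected components (any finite enumeration; here `Finset.univ`). [folklore] -/
theorem iff_exists_compOf (b : Tor M) : S b ↔ ∃ c ∈ (Finset.univ : Finset (faceGraphOn M S).ConnectedComponent), compOf M S c b :=
  ⟨fun h => ⟨(faceGraphOn M S).connectedComponentMk ⟨b, h⟩, Finset.mem_univ _, h, rfl⟩, fun ⟨_, _, h⟩ => h.1⟩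

omit hM [DecidablePred S] in
/-- **DISTINCT FACE-CONNECTED COMPONENTS ARE SEPARATED** (no equal block: same vertex; no face-adjacent pair: adjacent vertices are
reachable). [folklore] -/
theorem separated_compOf {c c' : (faceGraphOn M S).ConnectedComponent} (hcc' : c ≠ c') : Separated M (compOf M S c) (compOf M S c') := by
  intro b₁ b₂ h₁ h₂
  obtain ⟨hS₁, hc₁⟩ := h₁
  obtain ⟨hS₂, hc₂⟩ := h₂
  have hne : b₁ ≠ b₂ := by
    rintro rfl
    exact hcc' (hc₁.symm.trans hc₂)
  have key : ∀ μ, ¬ (b₂ = b₁ + unitVec M μ ∨ b₁ = b₂ + unitVec M μ) := by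
    intro μ hμ
    have hadj : (faceGraphOn M S).Adj ⟨b₁, hS₁⟩ ⟨b₂, hS₂⟩ := (faceGraphOn_adj M S _ _).mpr ((faceGraph_adj M b₁ b₂).mpr ⟨hne, μ, hμ⟩)
    exact hcc' (hc₁.symm.trans ((SimpleGraph.ConnectedComponent.sound hadj.reachable).trans hc₂))
  exact ⟨hne, fun μ => ⟨fun e => key μ (Or.inl e.symm), fun e => key μ (Or.inr e.symm)⟩⟩

/-! ## §2 The ENDs: block sets all of whose face-connected components are locally monotone (resp. boxes) -/

section Ends

variable (N R : ℕ) [NeZero N] [NeZero R] (a' : ℝ)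

/-- **THE Δ1-BESOV LAW FOR EVERY BLOCK SET ALL OF WHOSE FACE-CONNECTED COMPONENTS ARE LOCALLY MONOTONE**: `besovConst d a′ 6 48·√R/√N`,
no displayed binder beyond the class of the components. [folklore] -/
theorem injected_le_of_components_locallyMonotone (hcomp : ∀ c, LocallyMonotone M (compOf M S c)) (hN : 1 ≤ N) (hRN : 2 ≤ R * N)
    (ha' : 0 < a') :
    ‖(DOm (R * N) M a' (refineR N R M (blockReg N M S)))⁻¹ * JOm N R M (blockReg N M S)
        - JOm N R M (blockReg N M S) * (DOm N M a' (blockReg N M S))⁻¹‖ ≤ besovConst d a' 6 48 * Real.sqrt R / Real.sqrt N :=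
  injected_le_of_pairwise_separated_locallyMonotone N R M a' (compOf M S) hN hRN ha' Finset.univ
    (fun _ _ _ _ h => separated_compOf S h) (fun c _ => hcomp c) S (iff_exists_compOf S)

/-- **ROAD P2's BOX LAW FOR EVERY BLOCK SET ALL OF WHOSE FACE-CONNECTED COMPONENTS ARE COORDINATE BOXES**: `Cbox d R a′/N`. [folklore] -/
theorem injected_le_of_components_box (hcomp : ∀ c, IsCoordBox M (compOf M S c)) (hN : 1 ≤ N) (ha' : 0 < a') :
    ‖(DOm (R * N) M a' (refineR N R M (blockReg N M S)))⁻¹ * JOm N R M (blockReg N M S)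
        - JOm N R M (blockReg N M S) * (DOm N M a' (blockReg N M S))⁻¹‖ ≤ Cbox d R a' / N :=
  injected_le_of_pairwise_separated_box N R M a' (compOf M S) hN ha' Finset.univ (fun _ _ _ _ h => separated_compOf S h)
    (fun c _ => hcomp c) S (iff_exists_compOf S)

end Ends

section Tower

variable (L : ℕ) [NeZero L] (a' : ℝ)

/-- **THE Ω-RESTRICTED UNIT-LATTICE SCALAR FREE COVARIANCES OF EVERY BLOCK SET WITH LOCALLY MONOTONE FACE-CONNECTED COMPONENTS CONVERGE AT
THE RATE `(√L)⁻¹`** (`L ≥ 2`, `d ≥ 1`, `a′ > 0`), UNCONDITIONALLY. [folklore] -/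
theorem towerLimitRate_dirichletScalar_components_monotone (hL : 2 ≤ L) (hd : 0 < d) (ha' : 0 < a')
    (hcomp : ∀ c, LocallyMonotone M (compOf M S c)) :
    TowerLimitRate (QsR L M (blockReg (lev L 0) M S)) ((L : ℝ) ^ d) (fun k => (DsR L M a' (blockReg (lev L 0) M S) k)⁻¹)
      (Cpert 0 (2 * d * Real.sqrt ((gammaPs d a')⁻¹)) (besovConst d a' 6 48 * Real.sqrt (L : ℝ)) 0 0 0) ((Real.sqrt (L : ℝ))⁻¹) :=
  towerLimitRate_dirichletScalar_family_monotone L M a' (compOf M S) hL hd ha' Finset.univ (fun _ _ _ _ h => separated_compOf S h)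
    (fun c _ => hcomp c) S (iff_exists_compOf S)

/-- **… AND OF EVERY BLOCK SET WITH BOX COMPONENTS AT THE FULL RATE `L⁻¹`**. [folklore] -/
theorem towerLimitRate_dirichletScalar_components_box (hL : 2 ≤ L) (hd : 0 < d) (ha' : 0 < a') (hcomp : ∀ c, IsCoordBox M (compOf M S c)) :
    TowerLimitRate (QsR L M (blockReg (lev L 0) M S)) ((L : ℝ) ^ d) (fun k => (DsR L M a' (blockReg (lev L 0) M S) k)⁻¹)
      (Cpert 0 (2 * d * Real.sqrt ((gammaPs d a')⁻¹)) (Cbox d L a') 0 0 0) ((L : ℝ)⁻¹) :=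
  towerLimitRate_dirichletScalar_family_box L M a' (compOf M S) hL hd ha' Finset.univ (fun _ _ _ _ h => separated_compOf S h)
    (fun c _ => hcomp c) S (iff_exists_compOf S)

end Tower

/-! ## §3 (v1.1) The whole-set class implies the component class -/

section Inclusion

omit hM [DecidablePred S] in
/-- **LOCAL MONOTONICITY PASSES TO EVERY FACE-CONNECTED COMPONENT**: if `S` is locally monotone then so is each `compOf M S c` — the lower
(resp. upper) face-neighbour that the whole-set class puts in `S` is face-adjacent to (or equal to) the block, hence in the same component.
So §2 CONTAINS leaf-08 g3's `DirichletScalarTowerMonotone` ENDs (the case of ONE class for the whole set). [folklore] -/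
theorem locallyMonotone_compOf (hS : LocallyMonotone M S) (c : (faceGraphOn M S).ConnectedComponent) : LocallyMonotone M (compOf M S c) := by
  intro v μ
  rcases hS v μ with hdown | hup
  · refine Or.inl fun b hb hvμ hbT => ?_
    obtain ⟨hbS, hbc⟩ := hbT
    have hS' : S (b - unitVec M μ) := hdown b hb hvμ hbS
    refine ⟨hS', ?_⟩
    by_cases heq : b - unitVec M μ = b
    · have e : (⟨b - unitVec M μ, hS'⟩ : {x // S x}) = ⟨b, hbS⟩ := Subtype.ext heq
      rw [e]; exact hbc
    · have hadj : (faceGraphOn M S).Adj ⟨b - unitVec M μ, hS'⟩ ⟨b, hbS⟩ :=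
        (faceGraphOn_adj M S _ _).mpr ((faceGraph_adj M _ _).mpr ⟨heq, μ, Or.inl (sub_add_cancel b _).symm⟩)
      exact (SimpleGraph.ConnectedComponent.sound hadj.reachable).trans hbc
  · refine Or.inr fun b hb hvμ hbT => ?_
    obtain ⟨hbS, hbc⟩ := hbT
    have hS' : S (b + unitVec M μ) := hup b hb hvμ hbS
    refine ⟨hS', ?_⟩
    by_cases heq : b + unitVec M μ = b
    · have e : (⟨b + unitVec M μ, hS'⟩ : {x // S x}) = ⟨b, hbS⟩ := Subtype.ext heq
      rw [e]; exact hbc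
    · have hadj : (faceGraphOn M S).Adj ⟨b + unitVec M μ, hS'⟩ ⟨b, hbS⟩ :=
        (faceGraphOn_adj M S _ _).mpr ((faceGraph_adj M _ _).mpr ⟨heq, μ, Or.inr rfl⟩)
      exact (SimpleGraph.ConnectedComponent.sound hadj.reachable).trans hbc

variable (L : ℕ) [NeZero L] (a' : ℝ)

/-- CONSISTENCY (kernel): leaf-08 g3's monotone tower END re-derived through the component class. -/
example (hL : 2 ≤ L) (hd : 0 < d) (ha' : 0 < a') (hS : LocallyMonotone M S) :
    TowerLimitRate (QsR L M (blockReg (lev L 0) M S)) ((L : ℝ) ^ d) (fun k => (DsR L M a' (blockReg (lev L 0) M S) k)⁻¹)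
      (Cpert 0 (2 * d * Real.sqrt ((gammaPs d a')⁻¹)) (besovConst d a' 6 48 * Real.sqrt (L : ℝ)) 0 0 0) ((Real.sqrt (L : ℝ))⁻¹) :=
  towerLimitRate_dirichletScalar_components_monotone S L a' hL hd ha' (locallyMonotone_compOf S hS)

end Inclusion

end Summit.QuantumFields.BalabanUV.T4Continuum.DirichletDecoupledComponents

end
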